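import Literature.NumberTheory.Sieve.FGKMT2018RandomConstruction
import Literature.NumberTheory.Sieve.FGKMT2018Theorem2Assembly
import Literature.Combinatorics.Hypergraph.FGKMTCoveringSelection
import Literature.Probability.Moments.HoeffdingCountingRange
import HarnessLib

/-!
# Ford–Green–Konyagin–Maynard–Tao 2018 — Corollary 3 from Theorem 3 (PROVED)

Topic `Literature/NumberTheory/Sieve`. Source: K. Ford, B. Green, S. Konyagin, J. Maynard, T. Tao,
*Long gaps between primes*, J. Amer. Math. Soc. 31 (2018) 65–105 = arXiv:1412.5029, §4.3, proof of
Corollary 3 (pp. 12–13) [FordGreenKonyaginMaynardTao2018].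

Everything here is PROVED (no new named facts): the probabilistic covering theorem
`Literature.Combinatorics.Hypergraph.FGKMT2018_theorem3` (Theorem 3, typed in
`FGKMTProbabilisticCovering.lean`) implies the specialised covering statement
`FGKMT2018_corollary3` (Corollary 3 in the first-moment form consumed by the deduction of Theorem 2,
typed in `FGKMT2018RandomConstruction.lean`). Combined with
`fgkmt2018_theorem2_of_corollary3_theorem4` (file `FGKMT2018Theorem2Assembly.lean`) this reduces
Theorems 1–2 of the paper to the two named facts Theorem 3 (§5) and Theorem 4 (§6–§7).

The proof follows p. 12 of the paper with all randomness finite: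
* the uniform `t_p ∈ [0, 1]` are replaced by a uniform grid point `t_p ∈ {0, …, G − 1}`,
  `G = ⌈C_max log₂² x⌉`, and the intervals `𝓘_j` of length `5^{1-j} log 5 / C` by integer windows
  (`FGKMT2018.exists_windows`); the sets `I_j = {p : t_p ∈ 𝓘_j}` are selected by the COUNTING
  Hoeffding inequality `Literature.Probability.Moments.hoeffding_count_pi_Icc_abs_centered` and a
  union bound over `(q, j)` (`FGKMT2018.exists_grid_levels`), giving (4.30)
  `d_{I_j}(q) = 5^{1-j} log 5 + O_≤(3 / log₂² x)`;
* the «routine induction» (4.31) `P_j(q) = (1 + O_≤((4^j − 1) μ)) 5^{-j}` is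
  `FGKMT2018.levelProb_numerics` (valid while `4^m μ ≤ 1/100`);
* the parameters are `δ = x^{-1/20}`, `κ = 5^{-m}/2`, `D = 3`, `A = 2rm + 2`, and the smallness
  condition (4.5) is verified for large `x` from `10^m ≤ (log₂ x)^{log 10 / log 5}` and
  `log 10 / log 5 < 2`;
* Theorem 3 is applied through the first-moment selection
  `FGKMTCovering.exists_config_of_theorem3With`, so the conclusion is the upper bound
  `#{q uncovered} ≤ 3 · 5^{-m} #V` (the `∼` of Corollary 3 is not needed for Theorem 2).

## Main statements

* `FGKMT2018.levelProb_numerics` : the induction (4.31);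
* `FGKMT2018.exists_windows`, `FGKMT2018.exists_grid_levels` : discretised choice of the `I_j` (4.30);
* `fgkmt2018_corollary3_of_theorem3` : **Theorem 3 ⇒ Corollary 3** (first-moment form);
* `fgkmt2018_theorem2_of_theorem3_theorem4`, `fgkmt2018_theorem1_of_theorem3_theorem4`,
  `rankinConstant_of_fgkmt2018_theorem3_theorem4` : the chain Thm 3 ∧ Thm 4 ⇒ Thm 2 ⇒ Thm 1 ⇒
  `RankinConstant κ` for every `κ`.
-/

noncomputable section

open Finset Filter Topology Asymptotics
open Literature.Combinatorics.Hypergraph Literature.Combinatorics.Hypergraph.FGKMTCovering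
open Literature.Probability.Moments

namespace Literature.NumberTheory.Sieve

namespace FGKMT2018

/-! ### Numerical constants -/

/-- `log 5 ≤ 2`. [folklore] -/
private theorem log_five_le_two : Real.log 5 ≤ 2 := by
  rw [Real.log_le_iff_le_exp (by norm_num : (0:ℝ) < 5)]
  have h1 : (2.7182818283 : ℝ) < Real.exp 1 := Real.exp_one_gt_d9
  have h2 : Real.exp 2 = Real.exp 1 * Real.exp 1 := by rw [← Real.exp_add]; norm_num
  rw [h2]; nlinarith [Real.exp_pos 1]

/-- `1 ≤ log 5`. [folklore] -/
private theorem one_le_log_five : 1 ≤ Real.log 5 := by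
  rw [Real.le_log_iff_exp_le (by norm_num : (0:ℝ) < 5)]
  have := Real.exp_one_lt_d9
  linarith

/-! ### The routine induction (4.31) -/

/-- One step of the `P_j` recursion: if `|θ| ≤ T ≤ 1/100` and `|μ'| ≤ μ ≤ 1/100` then
`|(1 + θ) exp(log 5 (θ − μ')/(1 + θ)) − 1| ≤ 3.2 T + 2.2 μ`.
[cite: FordGreenKonyaginMaynardTao2018, §4.3 (4.31) («a routine induction»)] -/
theorem recursion_step {θ μ' T μ : ℝ} (hT : |θ| ≤ T) (hμ' : |μ'| ≤ μ) (hT1 : T ≤ 1 / 100)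
    (hμ1 : μ ≤ 1 / 100) :
    |(1 + θ) * Real.exp (Real.log 5 * (θ - μ') / (1 + θ)) - 1| ≤ 3.2 * T + 2.2 * μ := by
  have hT0 : 0 ≤ T := (abs_nonneg _).trans hT
  have hμ0 : 0 ≤ μ := (abs_nonneg _).trans hμ'
  have hθ := abs_le.1 hT
  have hμ'' := abs_le.1 hμ'
  have h1θ : 99 / 100 ≤ 1 + θ := by linarith
  have h1θpos : 0 < 1 + θ := by linarith
  set z : ℝ := Real.log 5 * (θ - μ') / (1 + θ) with hz
  have hl5 := log_five_le_two
  have hl50 : 0 < Real.log 5 := Real.log_pos (by norm_num)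
  have hzb : |z| ≤ 2.03 * (T + μ) := by
    rw [hz, abs_div, abs_mul, abs_of_pos hl50, abs_of_pos h1θpos, div_le_iff₀ h1θpos]
    have hdiff : |θ - μ'| ≤ T + μ := (abs_sub _ _).trans (add_le_add hT hμ')
    calc Real.log 5 * |θ - μ'| ≤ 2 * (T + μ) := by
          apply mul_le_mul hl5 hdiff (abs_nonneg _) (by norm_num)
      _ ≤ 2.03 * (T + μ) * (1 + θ) := by nlinarith
  have hz1 : |z| ≤ 1 := hzb.trans (by nlinarith)
  have hzs : |z| ≤ 0.0406 := hzb.trans (by nlinarith)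
  have hexp : |Real.exp z - 1| ≤ 1.0406 * |z| := by
    have h := Real.abs_exp_sub_one_sub_id_le hz1
    have h2 : |Real.exp z - 1| ≤ |z| + z ^ 2 := by
      have := abs_add_le (Real.exp z - 1 - z) z
      simp only [sub_add_cancel] at this
      linarith
    have h3 : z ^ 2 = |z| * |z| := by rw [abs_mul_abs_self z, sq]
    nlinarith [abs_nonneg z]
  have hexp' : |Real.exp z - 1| ≤ 2.113 * (T + μ) := by nlinarith [abs_nonneg z]
  have hexpabs : |Real.exp z| ≤ 1 + 2.113 * (T + μ) := by
    have := abs_add_le (Real.exp z - 1) 1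
    simp only [sub_add_cancel, abs_one] at this
    linarith
  calc |(1 + θ) * Real.exp z - 1| = |θ * Real.exp z + (Real.exp z - 1)| := by ring_nf
    _ ≤ |θ * Real.exp z| + |Real.exp z - 1| := abs_add_le _ _
    _ = |θ| * |Real.exp z| + |Real.exp z - 1| := by rw [abs_mul]
    _ ≤ T * (1 + 2.113 * (T + μ)) + 2.113 * (T + μ) := by
        apply add_le_add _ hexp'
        exact mul_le_mul hT hexpabs (abs_nonneg _) hT0
    _ ≤ 3.2 * T + 2.2 * μ := by nlinarith

/-- **The routine induction (4.31)**, abstract form: if `P_0 = 1`,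
`P_{j+1} = P_j exp(−d_{j+1}/P_j)` and `d_{j+1} = (1 + O_≤(μ)) 5^{-j} log 5` for `j < m`, with
`4^m μ ≤ 1/100`, then `P_j = (1 + O_≤((4^j − 1) μ)) 5^{-j}` for `0 ≤ j ≤ m`.
[cite: FordGreenKonyaginMaynardTao2018, §4.3 (4.31)] -/
theorem levelProb_numerics {m : ℕ} {μ : ℝ} (hμ0 : 0 ≤ μ) (hμ : 4 ^ m * μ ≤ 1 / 100)
    (P d : ℕ → ℝ) (hP0 : P 0 = 1)
    (hP : ∀ j < m, P (j + 1) = P j * Real.exp (-(d (j + 1) / P j)))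
    (hd : ∀ j < m, |d (j + 1) - Real.log 5 / 5 ^ j| ≤ μ * (Real.log 5 / 5 ^ j)) :
    ∀ j ≤ m, |P j * 5 ^ j - 1| ≤ (4 ^ j - 1) * μ := by
  have h4m : (1 : ℝ) ≤ 4 ^ m := one_le_pow₀ (by norm_num)
  have hμ1 : μ ≤ 1 / 100 := by nlinarith
  intro j
  induction j with
  | zero => intro _; simp [hP0]
  | succ j ih =>
    intro hj
    have hjm : j < m := Nat.lt_of_succ_le hj
    have IH := ih hjm.le
    set θ : ℝ := P j * 5 ^ j - 1 with hθ
    set T : ℝ := (4 ^ j - 1) * μ with hTdef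
    have h4j : (4 : ℝ) ^ j ≤ 4 ^ m := pow_le_pow_right₀ (by norm_num) hjm.le
    have h4j1 : (1 : ℝ) ≤ 4 ^ j := one_le_pow₀ (by norm_num)
    have hT1 : T ≤ 1 / 100 := by
      have : T ≤ 4 ^ m * μ := by rw [hTdef]; nlinarith
      linarith
    have hl50 : 0 < Real.log 5 := Real.log_pos (by norm_num)
    have h5j : (0 : ℝ) < 5 ^ j := by positivity
    set L : ℝ := Real.log 5 / 5 ^ j with hL
    have hL0 : 0 < L := div_pos hl50 h5j
    set μ' : ℝ := (d (j + 1) - L) / L with hμ'def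
    have hμ' : |μ'| ≤ μ := by
      rw [hμ'def, abs_div, abs_of_pos hL0, div_le_iff₀ hL0]
      exact hd j hjm
    have hθabs : |θ| ≤ T := IH
    have h1θ : 0 < 1 + θ := by
      have := (abs_le.1 hθabs).1
      linarith
    have hPj : P j = (1 + θ) / 5 ^ j := by
      rw [hθ]; field_simp; ring
    have hdj : d (j + 1) = L * (1 + μ') := by
      rw [hμ'def]; field_simp; ring
    have key : P (j + 1) * 5 ^ (j + 1) =
        (1 + θ) * Real.exp (Real.log 5 * (θ - μ') / (1 + θ)) := by
      rw [hP j hjm, hdj, hPj, pow_succ]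
      have hquot : L * (1 + μ') / ((1 + θ) / 5 ^ j) = Real.log 5 * (1 + μ') / (1 + θ) := by
        rw [hL]; field_simp
      rw [hquot]
      have hsplit : Real.log 5 * (θ - μ') / (1 + θ) =
          Real.log 5 + -(Real.log 5 * (1 + μ') / (1 + θ)) := by
        field_simp; ring
      rw [hsplit, Real.exp_add, Real.exp_log (by norm_num : (0 : ℝ) < 5)]
      field_simp
    rw [key]
    calc |(1 + θ) * Real.exp (Real.log 5 * (θ - μ') / (1 + θ)) - 1|
        ≤ 3.2 * T + 2.2 * μ := recursion_step hθabs hμ' hT1 hμ1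
      _ ≤ (4 ^ (j + 1) - 1) * μ := by rw [hTdef, pow_succ]; nlinarith

/-! ### Discretised choice of the level sets `I_j` -/

/-- **Integer windows.** Given `G` grid points and densities `λ_1, …, λ_m ≥ 0` with
`∑_j λ_j ≤ 1`, there are pairwise disjoint windows `A_j ⊆ {0, …, G−1}` with
`G λ_j − 1 ≤ #A_j ≤ G λ_j` (the intervals `𝓘_j` of (4.30′), discretised).
[cite: FordGreenKonyaginMaynardTao2018, §4.3 (proof of Corollary 3: the disjoint intervals 𝓘_j)] -/
theorem exists_windows (G m : ℕ) (lam : ℕ → ℝ) (hlam0 : ∀ j, 0 ≤ lam j)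
    (hsum : (G : ℝ) * ∑ k ∈ Finset.range m, lam (k + 1) ≤ G) :
    ∃ A : ℕ → Finset (Fin G),
      (∀ j₁ ∈ Finset.Icc 1 m, ∀ j₂ ∈ Finset.Icc 1 m, j₁ ≠ j₂ → Disjoint (A j₁) (A j₂)) ∧
      ∀ j ∈ Finset.Icc 1 m, (G : ℝ) * lam j - 1 ≤ #(A j) ∧ (#(A j) : ℝ) ≤ G * lam j := by
  set g : ℕ → ℕ := fun j => ⌊(G : ℝ) * lam j⌋₊ with hg
  set s : ℕ → ℕ := fun j => ∑ k ∈ Finset.range j, g (k + 1) with hs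
  have hsmono : ∀ a b, a ≤ b → s a ≤ s b := fun a b hab =>
    Finset.sum_le_sum_of_subset (Finset.range_subset_range.2 hab)
  have hsG : s m ≤ G := by
    have h1 : ((s m : ℕ) : ℝ) ≤ (G : ℝ) * ∑ k ∈ Finset.range m, lam (k + 1) := by
      rw [hs]; push_cast
      rw [Finset.mul_sum]
      exact Finset.sum_le_sum fun k _ => Nat.floor_le (mul_nonneg (Nat.cast_nonneg _) (hlam0 _))
    exact_mod_cast h1.trans hsum
  have hsucc : ∀ j, s (j + 1) = s j + g (j + 1) := fun j => Finset.sum_range_succ _ _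
  refine ⟨fun j => (Finset.Ico (s (j - 1)) (min (s j) G)).attachFin (fun a ha => by
    simp only [Finset.mem_Ico] at ha; omega), ?_, ?_⟩
  · intro j₁ hj₁ j₂ hj₂ hne
    rw [Finset.mem_Icc] at hj₁ hj₂
    rw [Finset.disjoint_left]
    intro a ha₁ ha₂
    rw [Finset.mem_attachFin, Finset.mem_Ico] at ha₁ ha₂
    rcases lt_or_gt_of_ne hne with h | h
    · have := hsmono j₁ (j₂ - 1) (by omega)
      omega
    · have := hsmono j₂ (j₁ - 1) (by omega)
      omega
  · intro j hj
    rw [Finset.mem_Icc] at hj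
    have hsj : s j ≤ G := (hsmono j m hj.2).trans hsG
    obtain ⟨j', rfl⟩ : ∃ j', j = j' + 1 := ⟨j - 1, by omega⟩
    simp only [Finset.card_attachFin, min_eq_left hsj, Nat.card_Ico, Nat.add_sub_cancel]
    rw [hsucc j', Nat.add_sub_cancel_left]
    have h0 : 0 ≤ (G : ℝ) * lam (j' + 1) := mul_nonneg (Nat.cast_nonneg _) (hlam0 _)
    exact ⟨by have := Nat.lt_floor_add_one ((G : ℝ) * lam (j' + 1)); simp only [hg]; linarith,
      Nat.floor_le h0⟩

/-- **Discretised Hoeffding selection of the level sets** ((4.30)): if `0 ≤ w_i(v) ≤ s` and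
`2 #V · m · exp(−2t²/(#ι s²)) < 1`, there is a grid assignment `τ : ι → {0,…,G−1}` such that for
every vertex `v` and every level `j ∈ [1, m]`,
`|∑_{i : τ_i ∈ A_j} w_i(v) − (#A_j/G) ∑_i w_i(v)| < t` (Hoeffding's inequality for the independent
uniform `τ_i` and a union bound over `(v, j)`, in counting form).
[cite: FordGreenKonyaginMaynardTao2018, §4.3 (proof of Corollary 3: Hoeffding + union bound)] -/
theorem exists_grid_levels {V ι : Type*} [Fintype V] [Fintype ι] [DecidableEq ι] [Nonempty ι]
    (w : ι → V → ℝ) {s t : ℝ} (hs : 0 < s) (hw0 : ∀ i v, 0 ≤ w i v) (hws : ∀ i v, w i v ≤ s)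
    (ht : 0 ≤ t) {G : ℕ} (hG : 0 < G) (m : ℕ) (A : ℕ → Finset (Fin G))
    (hunion : 2 * (Fintype.card V : ℝ) * m *
        Real.exp (-(2 * t ^ 2 / (Fintype.card ι * s ^ 2))) < 1) :
    ∃ τ : ι → Fin G, ∀ v, ∀ j ∈ Finset.Icc 1 m,
      |∑ i ∈ univ.filter (fun i => τ i ∈ A j), w i v - (#(A j) : ℝ) / G * ∑ i, w i v| < t := by
  classical
  haveI : Nonempty (Fin G) := ⟨⟨0, hG⟩⟩
  set bad : V → ℕ → Finset (ι → Fin G) := fun v j =>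
    univ.filter (fun τ : ι → Fin G =>
      t ≤ |∑ i ∈ univ.filter (fun i => τ i ∈ A j), w i v - (#(A j) : ℝ) / G * ∑ i, w i v|)
    with hbad
  have hS : 0 < ∑ _i : ι, (s - 0) ^ 2 := by
    rw [sub_zero, Finset.sum_const, Finset.card_univ, nsmul_eq_mul]
    exact mul_pos (by exact_mod_cast Fintype.card_pos) (by positivity)
  have hbadcard : ∀ v j, (#(bad v j) : ℝ) ≤
      2 * Real.exp (-(2 * t ^ 2 / (Fintype.card ι * s ^ 2))) * (G : ℝ) ^ Fintype.card ι := by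
    intro v j
    set g : ∀ _i : ι, Fin G → ℝ := fun i a => if a ∈ A j then w i v else 0 with hgdef
    have hgI : ∀ i a, g i a ∈ Set.Icc (0 : ℝ) s := by
      intro i a
      simp only [hgdef]
      split_ifs
      · exact ⟨hw0 i v, hws i v⟩
      · exact ⟨le_rfl, hs.le⟩
    have h := hoeffding_count_pi_Icc_abs_centered g (fun _ => (0 : ℝ)) (fun _ => s) hgI ht hS
    have hsum2 : ∑ _i : ι, (s - 0) ^ 2 = Fintype.card ι * s ^ 2 := by
      rw [sub_zero, Finset.sum_const, Finset.card_univ, nsmul_eq_mul]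
    have hprod : ∏ _i : ι, (Fintype.card (Fin G) : ℝ) = (G : ℝ) ^ Fintype.card ι := by
      rw [Finset.prod_const, Finset.card_univ, Fintype.card_fin]
    rw [hsum2, hprod] at h
    refine le_trans ?_ h
    have hcm : ∀ i, coordMean (g i) = (#(A j) : ℝ) / G * w i v := by
      intro i
      rw [coordMean, Fintype.card_fin]
      have : ∑ a, g i a = ∑ a ∈ (univ : Finset (Fin G)).filter (fun a => a ∈ A j), w i v := by
        rw [Finset.sum_filter]
      rw [this, Finset.filter_mem_eq_inter, Finset.univ_inter, Finset.sum_const, nsmul_eq_mul]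
      ring
    have hev : ∀ τ : ι → Fin G, ∑ i, (g i (τ i) - coordMean (g i)) =
        ∑ i ∈ univ.filter (fun i => τ i ∈ A j), w i v - (#(A j) : ℝ) / G * ∑ i, w i v := by
      intro τ
      have e1 : ∑ i ∈ univ.filter (fun i => τ i ∈ A j), w i v = ∑ i, g i (τ i) := by
        rw [Finset.sum_filter]
      rw [Finset.sum_sub_distrib, e1, Finset.mul_sum]
      simp only [hcm]
    gcongr
    · intro τ; simp only [Finset.mem_filter, Finset.mem_univ, true_and, hbad, hev]; exact id
  -- union bound
  by_contra hno
  push Not at hno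
  have hall : (univ : Finset (ι → Fin G)) ⊆
      (univ ×ˢ Finset.Icc 1 m).biUnion (fun p : V × ℕ => bad p.1 p.2) := by
    intro τ _
    obtain ⟨v, j, hj, hvj⟩ := hno τ
    rw [Finset.mem_biUnion]
    exact ⟨(v, j), Finset.mem_product.2 ⟨Finset.mem_univ _, hj⟩, by
      simp only [hbad, Finset.mem_filter, Finset.mem_univ, true_and]; exact hvj⟩
  have h1 : ((Fintype.card (ι → Fin G) : ℕ) : ℝ) ≤
      ∑ p ∈ (univ : Finset V) ×ˢ Finset.Icc 1 m, (#(bad p.1 p.2) : ℝ) := by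
    have := (Finset.card_le_card hall).trans Finset.card_biUnion_le
    rw [Finset.card_univ] at this
    exact_mod_cast this
  have h2 : ∑ p ∈ (univ : Finset V) ×ˢ Finset.Icc 1 m, (#(bad p.1 p.2) : ℝ) ≤
      (Fintype.card V : ℝ) * m *
        (2 * Real.exp (-(2 * t ^ 2 / (Fintype.card ι * s ^ 2))) * (G : ℝ) ^ Fintype.card ι) := by
    calc ∑ p ∈ (univ : Finset V) ×ˢ Finset.Icc 1 m, (#(bad p.1 p.2) : ℝ)
        ≤ ∑ _p ∈ (univ : Finset V) ×ˢ Finset.Icc 1 m,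
            2 * Real.exp (-(2 * t ^ 2 / (Fintype.card ι * s ^ 2))) * (G : ℝ) ^ Fintype.card ι :=
          Finset.sum_le_sum fun p _ => hbadcard p.1 p.2
      _ = _ := by
          rw [Finset.sum_const, Finset.card_product, Finset.card_univ, Nat.card_Icc,
            nsmul_eq_mul]
          push_cast
          ring
  have hcardΩ : ((Fintype.card (ι → Fin G) : ℕ) : ℝ) = (G : ℝ) ^ Fintype.card ι := by
    rw [Fintype.card_fun, Fintype.card_fin]; push_cast; ring
  have hGpos : (0 : ℝ) < (G : ℝ) ^ Fintype.card ι := by positivity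
  have := h1.trans h2
  rw [hcardΩ] at this
  nlinarith

/-! ### Growth facts -/

/-- `Real.log^[2]`, `Real.log^[3]` unfolded. [folklore] -/
private theorem iterate_log_two_three' (w : ℝ) :
    Real.log^[2] w = Real.log (Real.log w) ∧
      Real.log^[3] w = Real.log (Real.log (Real.log w)) := by
  constructor <;> simp [Function.iterate_succ_apply']

/-- The exponents `log 10 / log 5 < 2` and `log 20 / log 5 < 2`. [folklore] -/
private theorem log_ratio_lt_two {a : ℝ} (ha0 : 0 < a) (ha : a < 25) : Real.log a / Real.log 5 < 2 := by
  have hl5 : 0 < Real.log 5 := Real.log_pos (by norm_num)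
  rw [div_lt_iff₀ hl5]
  have h25 : Real.log 25 = 2 * Real.log 5 := by
    rw [show (25 : ℝ) = 5 ^ 2 by norm_num, Real.log_pow]; push_cast; ring
  have := Real.log_lt_log ha0 ha
  linarith

/-- Growth facts used in the proof of Corollary 3, eventually in `x`. [folklore] -/
private theorem cor3_growth (K : ℝ) : ∀ᶠ x : ℕ in atTop,
    100 ≤ (x : ℝ) ∧ 1 ≤ Real.log x ∧ 1 ≤ Real.log (Real.log x) ∧
      1 ≤ Real.log (Real.log (Real.log x)) ∧
      (Real.log (Real.log x)) ^ 2 ≤ Real.log x ∧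
      3 * (Real.log x) ^ 5 ≤ (x : ℝ) ^ ((1 : ℝ) / 5) ∧
      300 ≤ (Real.log (Real.log x)) ^ (2 - Real.log 20 / Real.log 5) ∧
      K * (Real.log (Real.log (Real.log x))) ^ 3 ≤
        (Real.log (Real.log x)) ^ (2 - Real.log 10 / Real.log 5) := by
  have hℓ : Tendsto (fun x : ℕ => Real.log x) atTop atTop :=
    Real.tendsto_log_atTop.comp tendsto_natCast_atTop_atTop
  have hℓ₂ : Tendsto (fun x : ℕ => Real.log (Real.log x)) atTop atTop :=
    Real.tendsto_log_atTop.comp hℓ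
  have hℓ₃ : Tendsto (fun x : ℕ => Real.log (Real.log (Real.log x))) atTop atTop :=
    Real.tendsto_log_atTop.comp hℓ₂
  -- (log₂ x)² ≤ log x
  have hA : ∀ᶠ x : ℕ in atTop, (Real.log (Real.log x)) ^ 2 ≤ Real.log x := by
    have h := (isLittleO_log_rpow_atTop (show (0 : ℝ) < 1 / 2 by norm_num)).bound
      (show (0 : ℝ) < 1 by norm_num)
    filter_upwards [hℓ.eventually h, hℓ.eventually_ge_atTop 0, hℓ₂.eventually_ge_atTop 0]
      with x hx hL0 hL20
    have h1 : Real.log (Real.log (x : ℝ)) ≤ Real.log (x : ℝ) ^ ((1 : ℝ) / 2) := by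
      have h1 := hx
      simp only [Real.norm_eq_abs, one_mul] at h1
      rw [abs_of_nonneg hL20, abs_of_nonneg (Real.rpow_nonneg hL0 _)] at h1
      exact h1
    calc (Real.log (Real.log (x : ℝ))) ^ 2 ≤ (Real.log (x : ℝ) ^ ((1 : ℝ) / 2)) ^ 2 :=
          pow_le_pow_left₀ hL20 h1 2
      _ = Real.log x := by
          rw [← Real.rpow_natCast, ← Real.rpow_mul hL0]; norm_num
  -- 3 (log x)^5 ≤ x^{1/5}
  have hB : ∀ᶠ x : ℕ in atTop, 3 * (Real.log x) ^ 5 ≤ (x : ℝ) ^ ((1 : ℝ) / 5) := by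
    have h := (isLittleO_log_rpow_atTop (show (0 : ℝ) < 1 / 25 by norm_num)).bound
      (show (0 : ℝ) < 1 / 2 by norm_num)
    filter_upwards [tendsto_natCast_atTop_atTop.eventually h,
      tendsto_natCast_atTop_atTop.eventually_ge_atTop (0 : ℝ), hℓ.eventually_ge_atTop 0]
      with x hx hx0 hL0
    have h1 : Real.log (x : ℝ) ≤ 1 / 2 * (x : ℝ) ^ ((1 : ℝ) / 25) := by
      have h1 := hx
      simp only [Real.norm_eq_abs] at h1
      rw [abs_of_nonneg hL0, abs_of_nonneg (Real.rpow_nonneg hx0 _)] at h1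
      exact h1
    have h2 : (Real.log (x : ℝ)) ^ 5 ≤ (1 / 2 * (x : ℝ) ^ ((1 : ℝ) / 25)) ^ 5 :=
      pow_le_pow_left₀ hL0 h1 5
    have h3 : ((x : ℝ) ^ ((1 : ℝ) / 25)) ^ 5 = (x : ℝ) ^ ((1 : ℝ) / 5) := by
      rw [← Real.rpow_natCast, ← Real.rpow_mul hx0]; norm_num
    rw [mul_pow, h3] at h2
    have h4 : (0 : ℝ) ≤ (x : ℝ) ^ ((1 : ℝ) / 5) := Real.rpow_nonneg hx0 _
    nlinarith
  -- 300 ≤ (log₂ x)^{β₂₀}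
  have hβ20 : 0 < 2 - Real.log 20 / Real.log 5 := by
    have := log_ratio_lt_two (a := 20) (by norm_num) (by norm_num); linarith
  have hβ10 : 0 < 2 - Real.log 10 / Real.log 5 := by
    have := log_ratio_lt_two (a := 10) (by norm_num) (by norm_num); linarith
  have hC : ∀ᶠ x : ℕ in atTop, 300 ≤ (Real.log (Real.log x)) ^ (2 - Real.log 20 / Real.log 5) :=
    ((tendsto_rpow_atTop hβ20).comp hℓ₂).eventually_ge_atTop 300
  -- K (log₃ x)^3 ≤ (log₂ x)^{β₁₀}
  have hD : ∀ᶠ x : ℕ in atTop, K * (Real.log (Real.log (Real.log x))) ^ 3 ≤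
      (Real.log (Real.log x)) ^ (2 - Real.log 10 / Real.log 5) := by
    set β : ℝ := 2 - Real.log 10 / Real.log 5 with hβdef
    have hlo := (isLittleO_log_rpow_atTop (show (0 : ℝ) < β / 3 by positivity)).pow
      (show 0 < 3 by norm_num)
    have hε : (0 : ℝ) < 1 / (|K| + 1) := by positivity
    have h := hlo.bound hε
    filter_upwards [hℓ₂.eventually h, hℓ₂.eventually_ge_atTop 0, hℓ₃.eventually_ge_atTop 0]
      with x hx hL20 hL30
    have h1 : (Real.log (Real.log (Real.log (x : ℝ)))) ^ 3 ≤
        1 / (|K| + 1) * (Real.log (Real.log (x : ℝ))) ^ β := by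
      have h1 := hx
      simp only [Real.norm_eq_abs] at h1
      have h3 : (Real.log (Real.log (x : ℝ)) ^ (β / 3)) ^ 3 = (Real.log (Real.log (x : ℝ))) ^ β := by
        rw [← Real.rpow_natCast, ← Real.rpow_mul hL20]
        congr 1
        push_cast
        ring
      rw [abs_of_nonneg (pow_nonneg hL30 3), abs_of_nonneg (pow_nonneg (Real.rpow_nonneg hL20 _) 3),
        h3] at h1
      exact h1
    have hpow0 : 0 ≤ (Real.log (Real.log (x : ℝ))) ^ β := Real.rpow_nonneg hL20 _
    have hK : K ≤ |K| := le_abs_self K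
    have hK1 : 0 < |K| + 1 := by positivity
    calc K * (Real.log (Real.log (Real.log (x : ℝ)))) ^ 3
        ≤ (|K| + 1) * (Real.log (Real.log (Real.log (x : ℝ)))) ^ 3 := by
          apply mul_le_mul_of_nonneg_right (by linarith) (pow_nonneg hL30 3)
      _ ≤ (|K| + 1) * (1 / (|K| + 1) * (Real.log (Real.log (x : ℝ))) ^ β) :=
          mul_le_mul_of_nonneg_left h1 hK1.le
      _ = (Real.log (Real.log (x : ℝ))) ^ β := by field_simp
  filter_upwards [tendsto_natCast_atTop_atTop.eventually_ge_atTop (100 : ℝ),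
    hℓ.eventually_ge_atTop 1, hℓ₂.eventually_ge_atTop 1, hℓ₃.eventually_ge_atTop 1, hA, hB, hC,
    hD] with x h1 h2 h3 h4 h5 h6 h7 h8
  exact ⟨h1, h2, h3, h4, h5, h6, h7, h8⟩

/-- `b^m ≤ (log₂ x)^{log b / log 5}` when `m ≤ log₃ x / log 5` (`b ≥ 1`). [folklore] -/
private theorem pow_le_rpow_loglog {b : ℝ} (hb : 1 ≤ b) {m : ℕ} {ℓ₂ : ℝ} (hℓ₂ : 0 < ℓ₂)
    (hm : (m : ℝ) ≤ Real.log ℓ₂ / Real.log 5) :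
    b ^ m ≤ ℓ₂ ^ (Real.log b / Real.log 5) := by
  have hl5 : 0 < Real.log 5 := Real.log_pos (by norm_num)
  have hb0 : 0 < b := by linarith
  have hlb : 0 ≤ Real.log b := Real.log_nonneg hb
  rw [← Real.rpow_natCast, Real.rpow_def_of_pos hb0, Real.rpow_def_of_pos hℓ₂]
  apply Real.exp_le_exp.2
  calc Real.log b * (m : ℝ) ≤ Real.log b * (Real.log ℓ₂ / Real.log 5) :=
        mul_le_mul_of_nonneg_left hm hlb
    _ = Real.log ℓ₂ * (Real.log b / Real.log 5) := by ring

end FGKMT2018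

open FGKMT2018

/-! ### Corollary 3 from Theorem 3 -/

set_option maxHeartbeats 8000000 in
/-- **Corollary 3 of FGKMT from Theorem 3 (Probabilistic covering)**, first-moment form
(`FGKMT2018_corollary3`): for every `K₀, C_max` there is `K` (here `K = 3`) such that for all large
`x`, every system of random edges `𝐞_i` (`i ∈ ι`, `#ι ≤ x`) on a vertex set `V` (`#V ≤ x²`) with
edge sizes `≤ r ≤ K₀ log x log₃ x / log₂² x`, sparsity `x^{-3/5}`, uniform covering
`∑_i P(v ∈ 𝐞_i) = C + O_≤(1/log₂² x)` (`(5/4) log 5 ≤ C ≤ C_max`) and small codegrees `x^{-1/20}`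
admits realisations `e'_i ∈ supp(𝐞_i) ∪ {∅}` leaving at most `K 5^{-m} #V` vertices uncovered, for
any `m ≤ log₃ x / log 5`. The proof is the one on pp. 12–13 of the paper with the level sets `I_j`
chosen by a discretised Hoeffding/union-bound argument and Theorem 3 applied with
`δ = x^{-1/20}`, `κ = 5^{-m}/2`, `D = 3`, `A = 2rm + 2`.
[cite: FordGreenKonyaginMaynardTao2018, Cor 3 (proof, §4.3 pp. 12–13)] -/
theorem fgkmt2018_corollary3_of_theorem3 (h : FGKMT2018_theorem3) : FGKMT2018_corollary3 := by
  obtain ⟨C₀, hC₀, h3⟩ := h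
  intro K₀ Cmax hK₀ hCmax
  refine ⟨3, by norm_num, ?_⟩
  filter_upwards [cor3_growth (2000 * (10 * K₀ + 10 + C₀))] with x hx
  obtain ⟨hx100, hℓ1, hℓ₂1, hℓ₃1, hℓ₂sq, hx5, hg20, hg10⟩ := hx
  intro V ι _ _ _ _ r C m μ hι hV hr1 hrK hC hCC hm hlaw hsize hsp hcov hcod
  obtain ⟨i2, i3⟩ := iterate_log_two_three' (x : ℝ)
  simp only [i2, i3] at hrK hm hcov
  -- abbreviations and elementary facts
  set ℓ : ℝ := Real.log x with hℓ
  set ℓ₂ : ℝ := Real.log ℓ with hℓ₂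
  set ℓ₃ : ℝ := Real.log ℓ₂ with hℓ₃
  have hx0 : (0 : ℝ) < x := by linarith
  have hx1 : (1 : ℝ) ≤ x := by linarith
  have hℓ0 : 0 < ℓ := by linarith
  have hℓ₂0 : 0 < ℓ₂ := by linarith
  have hℓ₃0 : 0 < ℓ₃ := by linarith
  have hl5 : 1 ≤ Real.log 5 := one_le_log_five
  have hl52 : Real.log 5 ≤ 2 := log_five_le_two
  have hl50 : 0 < Real.log 5 := by linarith
  have hC1 : 5 / 4 ≤ C := by nlinarith
  have hC0 : 0 < C := by linarith
  have hℓ₂leℓ : ℓ₂ ≤ ℓ := (Real.log_le_sub_one_of_pos hℓ0).trans (by linarith)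
  have hℓ₃leℓ₂ : ℓ₃ ≤ ℓ₂ := (Real.log_le_sub_one_of_pos hℓ₂0).trans (by linarith)
  have hℓlex : ℓ ≤ x := (Real.log_le_sub_one_of_pos hx0).trans (by linarith)
  have hmℓ₃ : (m : ℝ) * Real.log 5 ≤ ℓ₃ := by rwa [le_div_iff₀ hl50] at hm
  have hm0 : (0 : ℝ) ≤ m := Nat.cast_nonneg m
  have hmle : (m : ℝ) ≤ ℓ₃ := le_trans (by nlinarith) hmℓ₃
  have hpm0 : ∀ i v, 0 ≤ probMem (μ i) v := fun i v =>
    Finset.sum_nonneg fun S _ => (hlaw i).1 S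
  have hpp0 : ∀ i v₁ v₂, 0 ≤ probPairMem (μ i) v₁ v₂ := fun i v₁ v₂ =>
    Finset.sum_nonneg fun S _ => (hlaw i).1 S
  -- degenerate case: `V` empty
  rcases isEmpty_or_nonempty V with hVe | hVne
  · refine ⟨fun _ => ∅, fun i => Or.inl rfl, ?_⟩
    have hV0 : (Fintype.card V : ℝ) = 0 := by rw [Fintype.card_eq_zero]; simp
    refine le_trans (b := (Fintype.card V : ℝ)) ?_ ?_
    · exact_mod_cast (Finset.card_le_univ _)
    · rw [hV0]; simp
  obtain ⟨v₀⟩ := hVne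
  -- `ι` is nonempty (else the uniform covering hypothesis fails at `v₀`)
  haveI : Nonempty ι := by
    by_contra hι0
    rw [not_nonempty_iff] at hι0
    have h1 := hcov v₀
    have h0 : ∑ i, probMem (μ i) v₀ = 0 := by
      rw [Finset.univ_eq_empty, Finset.sum_empty]
    rw [h0, zero_sub, abs_neg, abs_of_pos hC0] at h1
    have h2 : 1 / ℓ₂ ^ 2 ≤ 1 := by
      rw [div_le_one (by positivity)]; nlinarith
    linarith
  have hιpos : (0 : ℝ) < Fintype.card ι := by exact_mod_cast Fintype.card_pos
  -- the sparsity scale, the tolerance and the grid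
  set sX : ℝ := (x : ℝ) ^ (-(3 / 5 : ℝ)) with hsX
  have hsX0 : 0 < sX := Real.rpow_pos_of_pos hx0 _
  set t : ℝ := 1 / ℓ₂ ^ 2 with ht
  have ht0 : 0 ≤ t := by positivity
  set G : ℕ := ⌈Cmax * ℓ₂ ^ 2⌉₊ with hGdef
  have hGge : Cmax * ℓ₂ ^ 2 ≤ G := Nat.le_ceil _
  have hGpos : 0 < G := Nat.ceil_pos.2 (by positivity)
  have hG0 : (0 : ℝ) < G := by exact_mod_cast hGpos
  set lam : ℕ → ℝ := fun j => Real.log 5 / (C * 5 ^ (j - 1)) with hlam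
  have hlam0 : ∀ j, 0 ≤ lam j := fun j =>
    div_nonneg hl50.le (mul_nonneg hC0.le (pow_nonneg (by norm_num) _))
  have hlam1 : ∀ j, lam j ≤ 1 := by
    intro j
    have h5 : (1 : ℝ) ≤ 5 ^ (j - 1) := one_le_pow₀ (by norm_num)
    rw [hlam]
    rw [div_le_one (by positivity)]
    nlinarith
  -- the densities sum to at most `1` ((4.20): `C ≥ (5/4) log 5`)
  have hgeom : ∑ k ∈ Finset.range m, ((1 : ℝ) / 5) ^ k ≤ 5 / 4 := by
    rw [geom_sum_eq (by norm_num : (1 : ℝ) / 5 ≠ 1)]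
    have : (0 : ℝ) ≤ ((1 : ℝ) / 5) ^ m := by positivity
    rw [div_le_iff_of_neg (by norm_num : (1 : ℝ) / 5 - 1 < 0)]
    linarith
  have hsum : (G : ℝ) * ∑ k ∈ Finset.range m, lam (k + 1) ≤ G := by
    have h1 : ∑ k ∈ Finset.range m, lam (k + 1) =
        Real.log 5 / C * ∑ k ∈ Finset.range m, ((1 : ℝ) / 5) ^ k := by
      rw [Finset.mul_sum]
      refine Finset.sum_congr rfl fun k _ => ?_
      simp only [hlam, Nat.add_sub_cancel]
      rw [one_div_pow]
      field_simp
    have h2 : ∑ k ∈ Finset.range m, lam (k + 1) ≤ 1 := by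
      rw [h1]
      calc Real.log 5 / C * ∑ k ∈ Finset.range m, ((1 : ℝ) / 5) ^ k
          ≤ Real.log 5 / C * (5 / 4) := mul_le_mul_of_nonneg_left hgeom (by positivity)
        _ ≤ 1 := by rw [div_mul_eq_mul_div, div_le_one hC0]; linarith
    nlinarith
  obtain ⟨A, hAdisj, hAcard⟩ := exists_windows G m lam hlam0 hsum
  -- the union bound `2 #V m exp(−2t²/(#ι s²)) < 1`
  have hsX2 : sX ^ 2 = (x : ℝ) ^ (-(6 / 5 : ℝ)) := by
    rw [hsX, ← Real.rpow_natCast, ← Real.rpow_mul hx0.le]; norm_num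
  have hden : (Fintype.card ι : ℝ) * sX ^ 2 ≤ (x : ℝ) ^ (-(1 / 5 : ℝ)) := by
    rw [hsX2, show (-(1 / 5 : ℝ)) = 1 + (-(6 / 5 : ℝ)) by norm_num, Real.rpow_add hx0,
      Real.rpow_one]
    exact mul_le_mul_of_nonneg_right hι (Real.rpow_nonneg hx0.le _)
  have hdenpos : 0 < (Fintype.card ι : ℝ) * sX ^ 2 := mul_pos hιpos (pow_pos hsX0 2)
  have hE : 6 * ℓ ≤ 2 * t ^ 2 / (Fintype.card ι * sX ^ 2) := by
    have h1 : 2 * t ^ 2 / (x : ℝ) ^ (-(1 / 5 : ℝ)) ≤ 2 * t ^ 2 / (Fintype.card ι * sX ^ 2) :=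
      div_le_div_of_nonneg_left (by positivity) hdenpos hden
    refine le_trans ?_ h1
    rw [Real.rpow_neg hx0.le, div_inv_eq_mul, ht]
    have hℓ₂4 : ℓ₂ ^ 4 ≤ ℓ ^ 4 := pow_le_pow_left₀ hℓ₂0.le hℓ₂leℓ 4
    rw [show 2 * (1 / ℓ₂ ^ 2) ^ 2 * (x : ℝ) ^ ((1 : ℝ) / 5) = 2 * (x : ℝ) ^ ((1 : ℝ) / 5) / ℓ₂ ^ 4 by
      field_simp]
    rw [le_div_iff₀ (by positivity)]
    have hℓ4 : 0 ≤ ℓ ^ 4 := by positivity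
    nlinarith
  have hunion : 2 * (Fintype.card V : ℝ) * m *
      Real.exp (-(2 * t ^ 2 / (Fintype.card ι * sX ^ 2))) < 1 := by
    have h1 : Real.exp (-(2 * t ^ 2 / (Fintype.card ι * sX ^ 2))) ≤ Real.exp (-(6 * ℓ)) :=
      Real.exp_le_exp.2 (by linarith)
    have h2 : Real.exp (-(6 * ℓ)) = ((x : ℝ) ^ 6)⁻¹ := by
      rw [Real.exp_neg, show (6 : ℝ) * ℓ = ((6 : ℕ) : ℝ) * ℓ by norm_num, Real.exp_nat_mul, hℓ,
        Real.exp_log hx0]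
    have h3 : 2 * (Fintype.card V : ℝ) * m ≤ 2 * (x : ℝ) ^ 2 * x := by
      have hm' : (m : ℝ) ≤ x := by linarith
      have hV0 : (0 : ℝ) ≤ Fintype.card V := Nat.cast_nonneg _
      nlinarith
    calc 2 * (Fintype.card V : ℝ) * m * Real.exp (-(2 * t ^ 2 / (Fintype.card ι * sX ^ 2)))
        ≤ 2 * (x : ℝ) ^ 2 * x * ((x : ℝ) ^ 6)⁻¹ :=
          mul_le_mul h3 (h1.trans_eq h2) (Real.exp_pos _).le (by positivity)
      _ = 2 / (x : ℝ) ^ 3 := by field_simp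
      _ < 1 := by rw [div_lt_one (by positivity)]; nlinarith
  -- the level sets `I_j = {i : τ_i ∈ A_j}` ((4.30))
  obtain ⟨τ, hτ⟩ := exists_grid_levels (fun i v => probMem (μ i) v) hsX0 hpm0 hsp ht0 hGpos m A
    hunion
  set I : ℕ → Finset ι := fun j => univ.filter (fun i => τ i ∈ A j) with hI
  set η : ℝ := 3 / ℓ₂ ^ 2 with hη
  have hη0 : 0 ≤ η := by positivity
  have hd : ∀ v, ∀ j ∈ Finset.Icc 1 m,
      |normDegree μ (I j) v - Real.log 5 / 5 ^ (j - 1)| ≤ η := by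
    intro v j hj
    set ρ : ℝ := (#(A j) : ℝ) / G with hρ
    set W : ℝ := ∑ i, probMem (μ i) v with hW
    have h1 : |∑ i ∈ I j, probMem (μ i) v - ρ * W| < t := hτ v j hj
    have hWC : |W - C| ≤ 1 / ℓ₂ ^ 2 := hcov v
    obtain ⟨hAl, hAu⟩ := hAcard j hj
    have hρu : ρ ≤ lam j := by rw [hρ, div_le_iff₀ hG0]; linarith
    have hρl : lam j - 1 / G ≤ ρ := by
      rw [hρ, le_div_iff₀ hG0, sub_mul, div_mul_cancel₀ _ hG0.ne']; linarith
    have hρ0 : 0 ≤ ρ := by positivity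
    have hρ1 : ρ ≤ 1 := hρu.trans (hlam1 j)
    have hρlam : |ρ - lam j| ≤ 1 / G := abs_le.2 ⟨by linarith, by linarith⟩
    have hlamC : C * lam j = Real.log 5 / 5 ^ (j - 1) := by
      simp only [hlam]; field_simp
    have hCG : C * (1 / G) ≤ 1 / ℓ₂ ^ 2 := by
      rw [mul_one_div, div_le_div_iff₀ hG0 (by positivity), one_mul]
      nlinarith
    have hdec : normDegree μ (I j) v - Real.log 5 / 5 ^ (j - 1) =
        (∑ i ∈ I j, probMem (μ i) v - ρ * W) + ρ * (W - C) + C * (ρ - lam j) := by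
      rw [← hlamC, normDegree]; ring
    rw [hdec]
    calc |(∑ i ∈ I j, probMem (μ i) v - ρ * W) + ρ * (W - C) + C * (ρ - lam j)|
        ≤ |∑ i ∈ I j, probMem (μ i) v - ρ * W| + |ρ * (W - C)| + |C * (ρ - lam j)| :=
          (abs_add_le _ _).trans (add_le_add (abs_add_le _ _) le_rfl)
      _ ≤ t + ρ * (1 / ℓ₂ ^ 2) + C * (1 / G) := by
          rw [abs_mul, abs_mul, abs_of_nonneg hρ0, abs_of_nonneg hC0.le]
          exact add_le_add (add_le_add h1.le (mul_le_mul_of_nonneg_left hWC hρ0))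
            (mul_le_mul_of_nonneg_left hρlam hC0.le)
      _ ≤ 1 / ℓ₂ ^ 2 + 1 * (1 / ℓ₂ ^ 2) + 1 / ℓ₂ ^ 2 := by
          apply add_le_add (add_le_add le_rfl (mul_le_mul_of_nonneg_right hρ1 (by positivity)))
            hCG
      _ = η := by rw [hη]; ring
  -- the relative error `μ` of (4.31) and its smallness `4^m μ ≤ 1/100`
  set μe : ℝ := η * 5 ^ m / Real.log 5 with hμe
  have hμe0 : 0 ≤ μe := div_nonneg (by positivity) hl50.le
  have h20 : (20 : ℝ) ^ m ≤ ℓ₂ ^ (Real.log 20 / Real.log 5) :=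
    pow_le_rpow_loglog (by norm_num) hℓ₂0 hm
  have hμe1 : 4 ^ m * μe ≤ 1 / 100 := by
    have hP0 : 0 < ℓ₂ ^ (2 - Real.log 20 / Real.log 5) := Real.rpow_pos_of_pos hℓ₂0 _
    have h1 : (4 : ℝ) ^ m * μe = 3 * (20 : ℝ) ^ m / (ℓ₂ ^ 2 * Real.log 5) := by
      rw [hμe, hη, show (20 : ℝ) ^ m = 4 ^ m * 5 ^ m by rw [← mul_pow]; norm_num]
      field_simp
    have h2 : 3 * (20 : ℝ) ^ m / (ℓ₂ ^ 2 * Real.log 5) ≤ 3 * (20 : ℝ) ^ m / ℓ₂ ^ 2 := by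
      apply div_le_div_of_nonneg_left (by positivity) (by positivity)
      have : 0 ≤ ℓ₂ ^ 2 := by positivity
      nlinarith
    have h3 : ℓ₂ ^ (Real.log 20 / Real.log 5) = ℓ₂ ^ 2 / ℓ₂ ^ (2 - Real.log 20 / Real.log 5) := by
      rw [Real.rpow_sub hℓ₂0, Real.rpow_two]; field_simp
    calc (4 : ℝ) ^ m * μe = 3 * (20 : ℝ) ^ m / (ℓ₂ ^ 2 * Real.log 5) := h1
      _ ≤ 3 * (20 : ℝ) ^ m / ℓ₂ ^ 2 := h2
      _ ≤ 3 * ℓ₂ ^ (Real.log 20 / Real.log 5) / ℓ₂ ^ 2 := by gcongr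
      _ = 3 / ℓ₂ ^ (2 - Real.log 20 / Real.log 5) := by rw [h3]; field_simp
      _ ≤ 1 / 100 := by rw [div_le_div_iff₀ hP0 (by norm_num)]; linarith
  have hμe1' : μe ≤ 1 / 100 := le_trans (by nlinarith [one_le_pow₀ (by norm_num : (1:ℝ) ≤ 4) (n := m)]) hμe1
  have hηm : η ≤ Real.log 5 / (100 * 5 ^ m) := by
    rw [le_div_iff₀ (by positivity)]
    have : η * 5 ^ m ≤ 1 / 100 * Real.log 5 := by
      rw [hμe, div_le_iff₀ hl50] at hμe1'; exact hμe1'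
    linarith
  -- (4.31): `P_j(v) = (1 + O_≤((4^j − 1) μ)) 5^{-j}`
  have hnum : ∀ v, ∀ j ≤ m, |levelProb μ I j v * 5 ^ j - 1| ≤ (4 ^ j - 1) * μe := by
    intro v
    refine levelProb_numerics hμe0 hμe1 (fun j => levelProb μ I j v)
      (fun j => normDegree μ (I j) v) rfl (fun j _ => rfl) ?_
    intro j hj
    have h1 := hd v (j + 1) (Finset.mem_Icc.2 ⟨by omega, by omega⟩)
    rw [Nat.add_sub_cancel] at h1
    refine h1.trans ?_
    have h2 : μe * (Real.log 5 / 5 ^ j) = η * (5 ^ m / 5 ^ j) := by rw [hμe]; field_simp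
    rw [h2]
    have h5 : (1 : ℝ) ≤ 5 ^ m / 5 ^ j := by
      rw [le_div_iff₀ (by positivity), one_mul]
      exact pow_le_pow_right₀ (by norm_num) hj.le
    nlinarith
  have hPb : ∀ v, ∀ j ≤ m,
      99 / 100 / 5 ^ j ≤ levelProb μ I j v ∧ levelProb μ I j v ≤ 101 / 100 / 5 ^ j := by
    intro v j hj
    have h1 := hnum v j hj
    have h4 : (4 : ℝ) ^ j ≤ 4 ^ m := pow_le_pow_right₀ (by norm_num) hj
    have h3 : |levelProb μ I j v * 5 ^ j - 1| ≤ 1 / 100 := h1.trans (by nlinarith)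
    have h5 : (0 : ℝ) < 5 ^ j := by positivity
    obtain ⟨hl, hu⟩ := abs_le.1 h3
    constructor
    · rw [div_le_iff₀ h5]; linarith
    · rw [le_div_iff₀ h5]; linarith
  -- parameters of Theorem 3
  set δ : ℝ := (x : ℝ) ^ (-(1 / 20 : ℝ)) with hδ
  have hδ0 : 0 < δ := Real.rpow_pos_of_pos hx0 _
  have hδ1 : δ ≤ 1 := Real.rpow_le_one_of_one_le_of_nonpos hx1 (by norm_num)
  set κ : ℝ := 1 / (2 * 5 ^ m) with hκ
  have hκ0 : 0 < κ := by positivity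
  have hκhalf : κ ≤ 1 / 2 := by
    rw [hκ]
    exact div_le_div_of_nonneg_left zero_le_one (by norm_num)
      (by nlinarith [one_le_pow₀ (by norm_num : (1 : ℝ) ≤ 5) (n := m)])
  set Ar : ℝ := 2 * r * m + 2 with hAr
  have hr0 : 0 ≤ r := by linarith
  have hAr0 : 0 ≤ 2 * r * m := by positivity
  have hA1 : (1 : ℝ) ≤ Ar := by linarith
  have hAm : 2 * r * m + 1 ≤ Ar := by linarith
  have hD : (1 : ℝ) ≤ 3 := by norm_num
  have hC₀0 : 0 < C₀ := by linarith
  -- the smallness condition (4.5)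
  have hsmall : δ ≤ (κ ^ Ar / (C₀ * Real.exp (Ar * 3))) ^ (10 ^ (m + 2) : ℕ) := by
    set B : ℝ := κ ^ Ar / (C₀ * Real.exp (Ar * 3)) with hB
    have hB0 : 0 < B := by positivity
    have hlogB : Real.log B = -(Ar * (Real.log 2 + m * Real.log 5 + 3) + Real.log C₀) := by
      rw [hB, Real.log_div (Real.rpow_pos_of_pos hκ0 _).ne' (by positivity), Real.log_mul hC₀0.ne'
        (Real.exp_pos _).ne', Real.log_exp, Real.log_rpow hκ0, hκ, one_div, Real.log_inv,
        Real.log_mul (by norm_num) (by positivity), Real.log_pow]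
      ring
    set Q : ℝ := ℓ * ℓ₃ ^ 3 / ℓ₂ ^ 2 with hQ
    have hQ1 : 1 ≤ Q := by
      rw [hQ, le_div_iff₀ (by positivity)]
      have : 1 ≤ ℓ₃ ^ 3 := one_le_pow₀ hℓ₃1
      nlinarith
    have hQℓ₃ : ℓ₃ ≤ Q := by
      rw [hQ, le_div_iff₀ (by positivity)]
      have h1 : ℓ₃ * ℓ₂ ^ 2 ≤ ℓ₃ * ℓ := mul_le_mul_of_nonneg_left hℓ₂sq hℓ₃0.le
      have h2 : 1 ≤ ℓ₃ ^ 2 := one_le_pow₀ hℓ₃1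
      have h3 : ℓ₃ ≤ ℓ₃ ^ 3 := by
        have := mul_le_mul_of_nonneg_left h2 hℓ₃0.le
        calc ℓ₃ = ℓ₃ * 1 := (mul_one _).symm
          _ ≤ ℓ₃ * ℓ₃ ^ 2 := this
          _ = ℓ₃ ^ 3 := by ring
      calc ℓ₃ * ℓ₂ ^ 2 ≤ ℓ₃ * ℓ := h1
        _ ≤ ℓ₃ ^ 3 * ℓ := mul_le_mul_of_nonneg_right h3 hℓ0.le
        _ = ℓ * ℓ₃ ^ 3 := by ring
    have hAr_le : Ar ≤ 2 * (K₀ * (ℓ * ℓ₃ / ℓ₂ ^ 2)) * ℓ₃ + 2 := by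
      rw [hAr]
      have : r * m ≤ (K₀ * (ℓ * ℓ₃ / ℓ₂ ^ 2)) * ℓ₃ := mul_le_mul hrK hmle hm0 (by positivity)
      linarith
    have hAr0' : 0 ≤ Ar := by linarith
    have hlog20 : 0 ≤ Real.log 2 := Real.log_nonneg (by norm_num)
    have hsum3 : 0 ≤ Real.log 2 + m * Real.log 5 + 3 := by
      have := mul_nonneg hm0 hl50.le
      linarith
    have hnegB : -Real.log B ≤ (10 * K₀ + 10 + C₀) * Q := by
      rw [hlogB, neg_neg]
      have hlog2 : Real.log 2 ≤ 1 := by have := Real.log_two_lt_d9; linarith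
      have hlogC₀ : Real.log C₀ ≤ C₀ := (Real.log_le_sub_one_of_pos hC₀0).trans (by linarith)
      have h1 : Real.log 2 + m * Real.log 5 + 3 ≤ 5 * ℓ₃ := by linarith
      have h5ℓ₃ : 0 ≤ 5 * ℓ₃ := by linarith
      have hQ' : ℓ * ℓ₃ / ℓ₂ ^ 2 * ℓ₃ * ℓ₃ = Q := by rw [hQ]; ring
      have hC₀Q : C₀ ≤ C₀ * Q := by
        have := mul_le_mul_of_nonneg_left hQ1 hC₀0.le
        linarith
      calc Ar * (Real.log 2 + m * Real.log 5 + 3) + Real.log C₀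
          ≤ Ar * (5 * ℓ₃) + C₀ := add_le_add (mul_le_mul_of_nonneg_left h1 hAr0') hlogC₀
        _ ≤ (2 * (K₀ * (ℓ * ℓ₃ / ℓ₂ ^ 2)) * ℓ₃ + 2) * (5 * ℓ₃) + C₀ :=
            add_le_add (mul_le_mul_of_nonneg_right hAr_le h5ℓ₃) le_rfl
        _ = 10 * K₀ * Q + 10 * ℓ₃ + C₀ := by rw [← hQ']; ring
        _ ≤ 10 * K₀ * Q + 10 * Q + C₀ * Q := by linarith
        _ = (10 * K₀ + 10 + C₀) * Q := by ring
    have hnegB0 : 0 ≤ -Real.log B := by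
      rw [hlogB, neg_neg]
      have h1 : 0 ≤ Real.log C₀ := Real.log_nonneg hC₀
      have h2 : 0 ≤ Ar * (Real.log 2 + m * Real.log 5 + 3) := mul_nonneg hAr0' hsum3
      linarith
    have h10 : (10 : ℝ) ^ m ≤ ℓ₂ ^ (Real.log 10 / Real.log 5) :=
      pow_le_rpow_loglog (by norm_num) hℓ₂0 hm
    set a : ℝ := Real.log 10 / Real.log 5 with ha
    have hPa : 0 < ℓ₂ ^ (2 - a) := Real.rpow_pos_of_pos hℓ₂0 _
    have hℓ₂a : ℓ₂ ^ a = ℓ₂ ^ 2 / ℓ₂ ^ (2 - a) := by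
      rw [Real.rpow_sub hℓ₂0, Real.rpow_two]; field_simp
    have hmain : (10 : ℝ) ^ (m + 2) * (-Real.log B) ≤ ℓ / 20 := by
      have hK2 : 2000 * (10 * K₀ + 10 + C₀) * ℓ₃ ^ 3 ≤ ℓ₂ ^ (2 - a) := hg10
      calc (10 : ℝ) ^ (m + 2) * (-Real.log B)
          ≤ (100 * ℓ₂ ^ a) * ((10 * K₀ + 10 + C₀) * Q) := by
            apply mul_le_mul _ hnegB hnegB0 (by positivity)
            rw [pow_add]; nlinarith [Real.rpow_nonneg hℓ₂0.le a]
        _ = 100 * (10 * K₀ + 10 + C₀) * ℓ * ℓ₃ ^ 3 / ℓ₂ ^ (2 - a) := by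
            rw [hℓ₂a, hQ]; field_simp
        _ ≤ ℓ / 20 := by
            rw [div_le_iff₀ hPa]
            nlinarith
    have hlogδ : Real.log δ = -(ℓ / 20) := by rw [hδ, Real.log_rpow hx0]; ring
    calc δ = Real.exp (Real.log δ) := (Real.exp_log hδ0).symm
      _ ≤ Real.exp (((10 ^ (m + 2) : ℕ) : ℝ) * Real.log B) :=
          Real.exp_le_exp.2 (by push_cast; linarith)
      _ = B ^ (10 ^ (m + 2)) := by rw [Real.exp_nat_mul, Real.exp_log hB0]
  -- the hypotheses of Theorem 3
  have hne : ∀ j ∈ Finset.Icc 1 m, (I j).Nonempty := by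
    intro j hj
    have h1 := hd v₀ j hj
    have hjm : j - 1 ≤ m := by rw [Finset.mem_Icc] at hj; omega
    have h5 : (5 : ℝ) ^ (j - 1) ≤ 5 ^ m := pow_le_pow_right₀ (by norm_num) hjm
    have h5p : (0 : ℝ) < 5 ^ (j - 1) := by positivity
    have hL : η < Real.log 5 / 5 ^ (j - 1) := by
      refine lt_of_le_of_lt hηm ?_
      rw [div_lt_div_iff₀ (by positivity) h5p]
      nlinarith
    have hpos : 0 < normDegree μ (I j) v₀ := by
      have := (abs_le.1 h1).1; linarith
    exact Finset.nonempty_of_sum_ne_zero hpos.ne'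
  have hdisj : ∀ j₁ ∈ Finset.Icc 1 m, ∀ j₂ ∈ Finset.Icc 1 m, j₁ ≠ j₂ →
      Disjoint (I j₁) (I j₂) := by
    intro j₁ hj₁ j₂ hj₂ hne'
    rw [Finset.disjoint_left]
    intro i hi₁ hi₂
    simp only [hI, Finset.mem_filter, Finset.mem_univ, true_and] at hi₁ hi₂
    exact Finset.disjoint_left.1 (hAdisj j₁ hj₁ j₂ hj₂ hne') hi₁ hi₂
  have hlaw' : ∀ j ∈ Finset.Icc 1 m, ∀ i ∈ I j, IsLaw (μ i) := fun j _ i _ => hlaw i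
  have hsize' : ∀ j ∈ Finset.Icc 1 m, ∀ i ∈ I j, ∀ S : Finset V, μ i S ≠ 0 → (S.card : ℝ) ≤ r :=
    fun j _ i _ S hS => hsize i S hS
  have hsparse' : ∀ j ∈ Finset.Icc 1 m, ∀ i ∈ I j, ∀ v : V,
      probMem (μ i) v ≤ δ / Real.sqrt ((I j).card : ℝ) := by
    intro j hj i hi v
    have hcardI : (#(I j) : ℝ) ≤ x := le_trans (by exact_mod_cast Finset.card_le_univ (I j)) hι
    have hIpos : (0 : ℝ) < #(I j) := by exact_mod_cast Finset.card_pos.2 ⟨i, hi⟩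
    have hsq : Real.sqrt (#(I j)) ≤ Real.sqrt x := Real.sqrt_le_sqrt hcardI
    have hsq0 : 0 < Real.sqrt (#(I j)) := Real.sqrt_pos.2 hIpos
    calc probMem (μ i) v ≤ (x : ℝ) ^ (-(3 / 5 : ℝ)) := hsp i v
      _ ≤ (x : ℝ) ^ (-(11 / 20 : ℝ)) := Real.rpow_le_rpow_of_exponent_le hx1 (by norm_num)
      _ = δ / Real.sqrt x := by
          rw [hδ, Real.sqrt_eq_rpow, ← Real.rpow_sub hx0]; norm_num
      _ ≤ δ / Real.sqrt (#(I j)) := div_le_div_of_nonneg_left hδ0.le hsq0 hsq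
  have hcodeg' : ∀ j ∈ Finset.Icc 1 m, ∀ v₁ v₂ : V, v₁ ≠ v₂ →
      ∑ i ∈ I j, probPairMem (μ i) v₁ v₂ ≤ δ := by
    intro j hj v₁ v₂ hne'
    calc ∑ i ∈ I j, probPairMem (μ i) v₁ v₂ ≤ ∑ i, probPairMem (μ i) v₁ v₂ :=
          Finset.sum_le_univ_sum_of_nonneg fun i => hpp0 i v₁ v₂
      _ ≤ δ := hcod v₁ v₂ hne'
  have hdeg : ∀ j ∈ Finset.Icc 1 m, ∀ v : V,
      normDegree μ (I j) v ≤ 3 * levelProb μ I (j - 1) v := by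
    intro j hj v
    have h1 := hd v j hj
    have hjm : j - 1 ≤ m := by rw [Finset.mem_Icc] at hj; omega
    obtain ⟨hPl, -⟩ := hPb v (j - 1) hjm
    have h5 : (5 : ℝ) ^ (j - 1) ≤ 5 ^ m := pow_le_pow_right₀ (by norm_num) hjm
    have h5p : (0 : ℝ) < 5 ^ (j - 1) := by positivity
    have hηj : η * 5 ^ (j - 1) ≤ Real.log 5 / 100 := by
      rw [le_div_iff₀ (by positivity)] at hηm
      nlinarith
    have hdu : normDegree μ (I j) v * 5 ^ (j - 1) ≤ Real.log 5 + η * 5 ^ (j - 1) := by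
      have := (abs_le.1 h1).2
      have h2 : normDegree μ (I j) v ≤ Real.log 5 / 5 ^ (j - 1) + η := by linarith
      calc normDegree μ (I j) v * 5 ^ (j - 1) ≤ (Real.log 5 / 5 ^ (j - 1) + η) * 5 ^ (j - 1) :=
            mul_le_mul_of_nonneg_right h2 h5p.le
        _ = Real.log 5 + η * 5 ^ (j - 1) := by field_simp
    have hPl' : 99 / 100 ≤ levelProb μ I (j - 1) v * 5 ^ (j - 1) := by
      rw [div_le_iff₀ h5p] at hPl; exact hPl
    have hkey : normDegree μ (I j) v * 5 ^ (j - 1) ≤ (3 * levelProb μ I (j - 1) v) * 5 ^ (j - 1) := by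
      nlinarith
    exact le_of_mul_le_mul_right hkey h5p
  have hκP : ∀ j ≤ m, ∀ v : V, κ ≤ levelProb μ I j v := by
    intro j hj v
    obtain ⟨hPl, -⟩ := hPb v j hj
    have h5 : (5 : ℝ) ^ j ≤ 5 ^ m := pow_le_pow_right₀ (by norm_num) hj
    have h5p : (0 : ℝ) < 5 ^ j := by positivity
    calc κ = 1 / (2 * 5 ^ m) := rfl
      _ ≤ 99 / 100 / 5 ^ m := by
          rw [div_le_div_iff₀ (by positivity) (by positivity)]; nlinarith
      _ ≤ 99 / 100 / 5 ^ j := div_le_div_of_nonneg_left (by norm_num) h5p h5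
      _ ≤ levelProb μ I j v := hPl
  -- apply Theorem 3 (first-moment selection) with `V' = V`
  obtain ⟨ω, hωs, hωc⟩ := exists_config_of_theorem3With h3 hD hr1 hA1 hκ0 hκhalf hδ0 hsmall hAm
    hne hdisj hlaw' hsize' hsparse' hcodeg' hdeg hκP (univ : Finset V)
  -- `e'_i := ∅` outside `⋃_j I_j`
  refine ⟨fun i => if i ∈ (Finset.Icc 1 m).biUnion I then ω i else ∅, ?_, ?_⟩
  · intro i
    dsimp only
    split_ifs with hi
    · obtain ⟨j, hj, hij⟩ := Finset.mem_biUnion.1 hi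
      exact hωs j hj i hij
    · exact Or.inl rfl
  · have hsumP : ∑ v ∈ (univ : Finset V), levelProb μ I m v ≤
        Fintype.card V * (101 / 100 / 5 ^ m) := by
      calc ∑ v ∈ (univ : Finset V), levelProb μ I m v
          ≤ ∑ _v ∈ (univ : Finset V), (101 / 100 / 5 ^ m : ℝ) :=
            Finset.sum_le_sum fun v _ => (hPb v m le_rfl).2
        _ = Fintype.card V * (101 / 100 / 5 ^ m) := by
            rw [Finset.sum_const, Finset.card_univ, nsmul_eq_mul]
    have hsumP0 : 0 ≤ ∑ v ∈ (univ : Finset V), levelProb μ I m v :=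
      Finset.sum_nonneg fun v _ => le_trans (by positivity) (hPb v m le_rfl).1
    have hδpow : δ ^ (1 / (10 : ℝ) ^ (m + 1)) ≤ 1 := Real.rpow_le_one hδ0.le hδ1 (by positivity)
    have hV0 : (0 : ℝ) ≤ Fintype.card V := Nat.cast_nonneg _
    refine le_trans (b := ((#(univ.filter (fun v => ∀ j ∈ (Finset.Icc 1 m : Finset ℕ),
      ∀ i ∈ I j, v ∉ ω i)) : ℕ) : ℝ)) ?_ ?_
    · exact_mod_cast Finset.card_le_card (fun v hv => by
        simp only [Finset.mem_filter, Finset.mem_univ, true_and] at hv ⊢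
        intro j hj i hi
        have := hv i
        rw [if_pos (Finset.mem_biUnion.2 ⟨j, hj, hi⟩)] at this
        exact this)
    · calc ((#(univ.filter (fun v => ∀ j ∈ (Finset.Icc 1 m : Finset ℕ),
            ∀ i ∈ I j, v ∉ ω i)) : ℕ) : ℝ)
          ≤ (1 + δ ^ (1 / (10 : ℝ) ^ (m + 1))) * ∑ v ∈ (univ : Finset V), levelProb μ I m v := hωc
        _ ≤ 2 * (Fintype.card V * (101 / 100 / 5 ^ m)) :=
            mul_le_mul (by linarith) hsumP hsumP0 (by norm_num)
        _ = (202 / 100 * Fintype.card V) / 5 ^ m := by ring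
        _ ≤ (3 * Fintype.card V) / 5 ^ m :=
            div_le_div_of_nonneg_right (by nlinarith) (by positivity)
        _ = 3 / 5 ^ m * Fintype.card V := by ring

/-! ### The chain down to Theorem 1 and the Rankin constant -/

/-- **FGKMT Theorem 2 from Theorems 3 and 4.** Combining `fgkmt2018_corollary3_of_theorem3`
with the assembly `fgkmt2018_theorem2_of_corollary3_theorem4` of §4.3: the sieving-primes
Theorem 2 follows from the (purely combinatorial) covering Theorem 3 and the random-construction
Theorem 4.
[cite: FordGreenKonyaginMaynardTao2018, Thm 2 from Thm 3 + Thm 4 (§4.3, pp. 12–13)] -/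
theorem fgkmt2018_theorem2_of_theorem3_theorem4 (h3 : FGKMT2018_theorem3)
    (h4 : FordGreenKonyaginMaynardTao2018_theorem4) : FordGreenKonyaginMaynardTao2018_theorem2 :=
  fgkmt2018_theorem2_of_corollary3_theorem4 (fgkmt2018_corollary3_of_theorem3 h3) h4

/-- **FGKMT Theorem 1 from Theorems 3 and 4** (large gaps between primes,
`G(X) ≫ log X log₂ X log₄ X / log₃ X`), via Theorem 2 and `fgkmt2018_theorem1_of_theorem2`.
[cite: FordGreenKonyaginMaynardTao2018, Thm 1 from Thm 3 + Thm 4 (§§3–4)] -/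
theorem fgkmt2018_theorem1_of_theorem3_theorem4 (h3 : FGKMT2018_theorem3)
    (h4 : FordGreenKonyaginMaynardTao2018_theorem4) : FordGreenKonyaginMaynardTao2018_theorem1 :=
  fgkmt2018_theorem1_of_corollary3_theorem4 (fgkmt2018_corollary3_of_theorem3 h3) h4

/-- **Every Rankin constant from Theorems 3 and 4**: `RankinConstant κ` for all real `κ`.
[cite: FordGreenKonyaginMaynardTao2018, Thm 1 ⇒ Rankin's conjecture (§1)] -/
theorem rankinConstant_of_fgkmt2018_theorem3_theorem4 (h3 : FGKMT2018_theorem3)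
    (h4 : FordGreenKonyaginMaynardTao2018_theorem4) (κ : ℝ) : RankinConstant κ :=
  rankinConstant_of_fgkmt2018_corollary3_theorem4 (fgkmt2018_corollary3_of_theorem3 h3) h4 κ

end Literature.NumberTheory.Sieve
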